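import Summits.QuantumFields.BalabanUV.Beta.GAN24.BornBorderContactNest
import Summits.QuantumFields.BalabanUV.Beta.GAN24.BornBorderContactLineage
import Summits.QuantumFields.BalabanUV.Beta.GAN24.BornBorderTent
import Summits.QuantumFields.BalabanUV.Beta.GAN24.BornBorderLift
import Summits.QuantumFields.BalabanUV.Beta.GAN24.BornLambdaBracketLetter

/-!
# `BalabanUV.Beta.GAN24.BornBorderContactBound` — binder row G-an2-4 / (CONV-C), CT-ROUTE, (C4)-V module (D), THE END: **THE CONTACT LETTER `hCgV` OF THE V-BORN ROW**
# at `d = 3`, `2 ≤ Lc`, pin `|cE| ≤ Lc^4`, every scale `cVH`, uniformly in the in-block root — LITERALLY the `hCg` binder of leaf-01 g60's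
# `BornBorderLetters.exists_hCv_of_polyGeometric` with `p = 1`, hypothesis-free

NOT IN PRINT; OUR BOOKKEEPING (G-an2-4 formalisation swarm → CRUX TEAM (2), leaf prover `b2b-balaban-gan24-formalise-leaf-03`, gen 55; (C4)-V typist of record per the OWNER's
W17, journal `CLAIMS.log` l.34977).  OUR PROOF ATTEMPT of the V analogue of the count BORNSEC-PLAN v1.1 §0 (c), assembled: (C1) `BornBorderContactNest` (the nested lineage and
its contact term, this seat's (A) `MultiplierLegWard` inside), (C2) `BornBorderContactLineage` (the weighted entry bound over (B1)(B2)(B3)), and the TREE letters — leaf-14's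
`RespStepDecay.exists_respStep_decay_and_grad` ((N1)), leaf-01's `DressedLegEnvelope.exists_legChain_envelope`, asym1's `FibreStrip.unitDecayK_holds` through gan24-p2's
`BornLambdaBracketLetter.abs_unitColumnTent_le` (the tent), the OWNER gan24-p1 g21's `BornBorderTent.legComp_colM∕rowMM_dec_respStep ∕ tentLeg_zsmul` and
`BornBorderLift.colM∕rowMM_KStepUnit` (the composite multiplier legs of the nested V lineage ARE `s_m² •` his tent leg), leaf-04's `Push4NestAux.legDecay_legComp`.
`d = 3` (§1 generic).  0 `def`, 0 cited facts, 0 `def … : Prop`, 0 sorry.  HONEST FRAMING (cell contract, verbatim): «discharging `BetaPertH` makes Bałaban's UV stability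
UNCONDITIONAL — a real milestone — but is NOT existence of continuum YM on T⁴ and NOT the Clay problem.»  This file proves the letter `hCgV` ((V-C)) and NOTHING ELSE: hB of
the V half of the comb family ⇐ (this) ∧ the OWNER's (V-U) socket ∕ `BornBorderLiftChain` ∕ `BornBorderUndressedRow` as staged; NEVER «G-an2-4 closed»; NOT (CONV-C), NOT D1,
NOT `BetaPertH`.  HONEST DEPENDENCY: continuum YM on T⁴ ⇐ BetaPertH ∧ nine spine estimates (0/9 proved); BetaPertH ⇐ (D1) ∧ (D4) ∧ CAP+tail; G-an2-4 gates asym, D1 and NE2/3/4.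

WHAT IS PROVED.
* §1 (generic `d`) `legComp_respStep_self` — the identity response is a unit for `legComp`; `legComp_colM_KStepUnit_respStep ∕ legComp_rowMM_KStepUnit_respStep` — the composite
  multiplier legs of the nested V lineage in closed form: `legComp (colM K̃_i Lc) (respStep (Lc^(i+1)) (Lc^(i+n+1))) = (smStep d Lc i)² • tentLeg Lc (Lc^n) (Lc^(i+n+1))` (the
  OWNER's tent leg); `abs_legComp_colM_zsmul_le ∕ abs_legComp_rowMM_zsmul_le` — THE TENT LETTER at the packed sites: `≤ C·e^{δ}·((Lc^n)^{2d+1})⁻¹·e^{−δ‖quo (Lc^n) y − z′‖∞}` from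
  the K-slot's unit decay (p2's `abs_unitColumnTent_le`); `exists_legDecay_mulLegs` — both composite legs are localised (`legDecay_legComp`), hence bounded and summable.
* §2 `exists_hCgV_three (hLc : 2 ≤ Lc) (cE cVH) (hcE : |cE| ≤ Lc^4) : ∃ C θ δ, 0 ≤ C ∧ 0 ≤ θ ∧ θ < 1 ∧ 0 < δ ∧ ∀ rr ∈ box (3+1) Lc, ∀ k i, i < k →
  LocStencil (D_{i,k} − U_{i,k}) (C·((k−i)^1·θ^{k−i})) δ` — `θ = Lc⁻¹`; per lineage `k = i+n+1`: (C1) rewrites the contact term (top `n = 0` ∕ nested `n = m+1`), (C2) bounds its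
  entries with the letters of §1 and the tree.  Consumed by leaf-01's `exists_hCv_of_polyGeometric (p := 1)` ∕ `exists_hBv_of_geometric_poly` and the OWNER's V socket.
* §3 `exists_hCv_three` — the docking certificate: leaf-01's `exists_hCv_of_polyGeometric (p := 1)` applied to §2 BY NAME, no rewrite (the contact part of the V-born row, summed
  over the lineages, is a local stencil family uniformly in the member and the root).
-/

open scoped BigOperators
open Literature.MathematicalPhysics.QuantumFieldTheory
open Literature.MathematicalPhysics.QuantumFieldTheory.LatticeForm (quo)
open Literature.MathematicalPhysics.QuantumFieldTheory.Balaban1983to89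
open Literature.MathematicalPhysics.QuantumFieldTheory.Balaban1983to89.Beta
open B4ContourShift (supNorm supNorm_nonneg)
open B12Sec2to5 (l1 l1_nonneg)
open ExpKernelCalculus (MKer Decays Zl Zl_nonneg)
open AffineAveraging (Site box toSite)
open AffineReproduction (contourSumAdj)
open AveragingHessianKernels (ell)
open AveragingHessianKernelsRooted (vhSAt)
open OneStepResolventKernel (Fib LocStencil KInv)
open OneStepKernelFamily (dec)
open BalabanCompositeJets (respStep)
open Summit.QuantumFields.BalabanUV.Beta.GAN24.CombesThomas (sfStep smStep KStepUnit UnitDecayK)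
open Summit.QuantumFields.BalabanUV.Beta.GAN24.FibreStrip (unitDecayK_holds)
open Summit.QuantumFields.BalabanUV.Beta.GAN24.Push4 (legComp legComp_apply)
open Summit.QuantumFields.BalabanUV.Beta.GAN24.Push4Bounds (LegDecay)
open Summit.QuantumFields.BalabanUV.Beta.GAN24.Push4Iter (LegFam legChain)
open Summit.QuantumFields.BalabanUV.Beta.GAN24.Push4NestAux (legDecay_legComp)
open Summit.QuantumFields.BalabanUV.Beta.GAN24.Push3 (push₃)
open Summit.QuantumFields.BalabanUV.Beta.GAN24.AffineUnroll (transport)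
open Summit.QuantumFields.BalabanUV.Beta.GAN24.RespStepSemigroup (respStep_self)
open Summit.QuantumFields.BalabanUV.Beta.GAN24.RespStepBmDecompPsi (decays_KStepUnit_levels legComp_smul_left)
open Summit.QuantumFields.BalabanUV.Beta.GAN24.RespStepBmDecompExact (respStepBmSeq)
open Summit.QuantumFields.BalabanUV.Beta.GAN24.SrecLinearPartEq (colM rowMM reslot legDecay_colM legDecay_rowMM)
open Summit.QuantumFields.BalabanUV.Beta.GAN24.SrecBornSector (unitStepMap)
open Summit.QuantumFields.BalabanUV.Beta.GAN24.UndressedResponseUnits (inv_cast_pow_pow)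
open Summit.QuantumFields.BalabanUV.Beta.GAN24.RespStepDecay (exists_respStep_decay_and_grad)
open Summit.QuantumFields.BalabanUV.Beta.GAN24.DressedLegEnvelope (exists_legChain_envelope)
open Summit.QuantumFields.BalabanUV.Beta.GAN24.BornLambdaBracketLetter (abs_unitColumnTent_le)
open Summit.QuantumFields.BalabanUV.Beta.GAN24.BornBorderTent (tentLeg tentLeg_zsmul legComp_colM_dec_respStep legComp_rowMM_dec_respStep)
open Summit.QuantumFields.BalabanUV.Beta.GAN24.BornBorderLift (colM_KStepUnit rowMM_KStepUnit)
open Summit.QuantumFields.BalabanUV.Beta.GAN24.BornBorderContactNest (exists_legDecay_respStep_multi contact_v_eq_of_succ contact_v_eq_of_top)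
open Summit.QuantumFields.BalabanUV.Beta.GAN24.BornBorderContactLineage (abs_weight_mul_contact_v_le_three)
open Summit.QuantumFields.BalabanUV.Beta.GAN24.BornBorderLetters (exists_hCv_of_polyGeometric)

namespace Summit.QuantumFields.BalabanUV.Beta.GAN24.BornBorderContactBound

/-! ## §1 The multiplier legs of the nested V lineage: closed form, tent, localisation -/

section Legs

variable {d : ℕ} {Lc : ℕ} [NeZero Lc]

omit [NeZero Lc] in
/-- [folklore] **THE IDENTITY RESPONSE IS A RIGHT UNIT OF `legComp`**: `legComp r (respStep M M) = r` (`respStep_self`: `respStep M M` is the Kronecker leg). -/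
theorem legComp_respStep_self (r : LegFam d) (M : ℕ) [NeZero M] : legComp r (respStep (d := d) M M) = r := by
  funext μ y κ u
  rw [legComp_apply, tsum_eq_single y]
  · rw [Finset.sum_eq_single μ]
    · rw [respStep_self, if_pos ⟨rfl, rfl⟩, one_mul]
    · intro lam _ hne
      rw [respStep_self, if_neg (fun h => hne h.2), zero_mul]
    · intro h; exact absurd (Finset.mem_univ μ) h
  · intro v hv
    refine Finset.sum_eq_zero fun lam _ => ?_
    rw [respStep_self, if_neg (fun h => hv h.1), zero_mul]

/-- NOT IN PRINT; OUR BOOKKEEPING ([folklore]).  **THE COMPOSITE `mm`-COLUMN LEG OF THE NESTED V LINEAGE IN CLOSED FORM**: for every `i, n`,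
`legComp (colM K̃_i Lc) (respStep (Lc^(i+1)) (Lc^(i+n+1))) = (smStep d Lc i)² • tentLeg Lc (Lc^n) (Lc^(i+n+1))` — the OWNER's `BornBorderLift.colM_KStepUnit` (`K̃_i`'s mm-column is
`s_m²` times the decimated one-shot resolvent's) and `BornBorderTent.legComp_colM_dec_respStep` (that composite IS the tent leg). -/
theorem legComp_colM_KStepUnit_respStep (i n : ℕ) :
    legComp (colM (KStepUnit (d := d) Lc i) Lc) (respStep (d := d) (Lc ^ (i + 1)) (Lc ^ (i + n + 1)))
      = (smStep d Lc i) ^ 2 • tentLeg (d := d) Lc (Lc ^ n) (Lc ^ (i + n + 1)) := by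
  rw [colM_KStepUnit, legComp_smul_left]
  congr 1
  funext β z' ν v
  exact legComp_colM_dec_respStep (pow_succ Lc i) (by ring) β z' ν v

/-- NOT IN PRINT; OUR BOOKKEEPING ([folklore]).  The same for the `mm`-ROW leg: `legComp (rowMM K̃_i Lc) (respStep (Lc^(i+1)) (Lc^(i+n+1))) = (smStep d Lc i)² • tentLeg Lc (Lc^n) (Lc^(i+n+1))`. -/
theorem legComp_rowMM_KStepUnit_respStep (i n : ℕ) :
    legComp (rowMM (KStepUnit (d := d) Lc i) Lc) (respStep (d := d) (Lc ^ (i + 1)) (Lc ^ (i + n + 1)))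
      = (smStep d Lc i) ^ 2 • tentLeg (d := d) Lc (Lc ^ n) (Lc ^ (i + n + 1)) := by
  rw [rowMM_KStepUnit, legComp_smul_left]
  congr 1
  funext α x' μ x
  exact legComp_rowMM_dec_respStep (pow_succ Lc i) (by ring) α x' μ x

/-- NOT IN PRINT; OUR BOOKKEEPING ([folklore] over the K-slot).  **THE TENT LETTER OF THE COMPOSITE `mm`-COLUMN LEG AT THE PACKED SITES**: from the K-slot's unit decay
`hK : UnitDecayK d Lc (sfStep Lc) (smStep d Lc) C δ`, for all `i n β z′ ν y`,
`|legComp (colM K̃_i Lc) (respStep (Lc^(i+1)) (Lc^(i+n+1))) β z′ ν (Lc•y)| ≤ C·e^{δ}·((Lc^n)^{2d+1})⁻¹·e^{−δ‖quo (Lc^n) y − z′‖∞}` — the closed form, `tentLeg_zsmul`, `s_m² = (Lc^i)^{2(d+1)}`,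
and gan24-p2's `abs_unitColumnTent_le`. -/
theorem abs_legComp_colM_zsmul_le {C δ : ℝ} (hK : UnitDecayK d Lc (sfStep Lc) (smStep d Lc) C δ) (hδ : 0 ≤ δ) (i n : ℕ) (β : Fin (d + 1))
    (z' : Site (d + 1)) (ν : Fin (d + 1)) (y : Site (d + 1)) :
    |legComp (colM (KStepUnit (d := d) Lc i) Lc) (respStep (d := d) (Lc ^ (i + 1)) (Lc ^ (i + n + 1))) β z' ν ((Lc : ℤ) • y)|
      ≤ C * Real.exp δ * ((((Lc : ℝ) ^ n) ^ (2 * d + 1))⁻¹) * Real.exp (-(δ * supNorm (quo (Lc ^ n) y - z'))) := by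
  rw [legComp_colM_KStepUnit_respStep]
  simp only [Pi.smul_apply, smul_eq_mul]
  rw [tentLeg_zsmul, show smStep d Lc i ^ 2 = ((Lc : ℝ) ^ i) ^ (2 * (d + 1)) by
    rw [smStep, ← pow_mul, ← pow_mul]; congr 1; ring]
  exact abs_unitColumnTent_le hK hδ i n β ν z' y

/-- NOT IN PRINT; OUR BOOKKEEPING ([folklore] over the K-slot).  The same tent letter for the composite `mm`-ROW leg (left multiplier slot), centred at its own packed site. -/
theorem abs_legComp_rowMM_zsmul_le {C δ : ℝ} (hK : UnitDecayK d Lc (sfStep Lc) (smStep d Lc) C δ) (hδ : 0 ≤ δ) (i n : ℕ) (α : Fin (d + 1))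
    (x' : Site (d + 1)) (μ : Fin (d + 1)) (y : Site (d + 1)) :
    |legComp (rowMM (KStepUnit (d := d) Lc i) Lc) (respStep (d := d) (Lc ^ (i + 1)) (Lc ^ (i + n + 1))) α x' μ ((Lc : ℤ) • y)|
      ≤ C * Real.exp δ * ((((Lc : ℝ) ^ n) ^ (2 * d + 1))⁻¹) * Real.exp (-(δ * supNorm (quo (Lc ^ n) y - x'))) := by
  rw [legComp_rowMM_KStepUnit_respStep]
  simp only [Pi.smul_apply, smul_eq_mul]
  rw [tentLeg_zsmul, show smStep d Lc i ^ 2 = ((Lc : ℝ) ^ i) ^ (2 * (d + 1)) by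
    rw [smStep, ← pow_mul, ← pow_mul]; congr 1; ring]
  exact abs_unitColumnTent_le hK hδ i n α μ x' y

/-- NOT IN PRINT; OUR BOOKKEEPING ([folklore]).  **BOTH COMPOSITE MULTIPLIER LEGS ARE LOCALISED** (hence bounded and summable in the fine slot): the top leg (`n = 0`) is `K̃_i`'s own
(`legComp_respStep_self`, `legDecay_colM ∕ legDecay_rowMM` on `decays_KStepUnit_levels`); the nested one composes it with the multi-step response above the birth level
((C1) `exists_legDecay_respStep_multi`) through leaf-04's `legDecay_legComp` at a composite rate. -/
theorem exists_legDecay_mulLegs (i n : ℕ) : ∃ (N : ℕ) (C m : ℝ), 0 < m ∧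
    LegDecay (legComp (colM (KStepUnit (d := d) Lc i) Lc) (respStep (d := d) (Lc ^ (i + 1)) (Lc ^ (i + n + 1)))) N C m ∧
      LegDecay (legComp (rowMM (KStepUnit (d := d) Lc i) Lc) (respStep (d := d) (Lc ^ (i + 1)) (Lc ^ (i + n + 1)))) N C m := by
  obtain ⟨CK, mK, hmK, hK⟩ := decays_KStepUnit_levels (d := d) (Lc := Lc) i
  have hc : LegDecay (colM (KStepUnit (d := d) Lc i) Lc) Lc CK mK := legDecay_colM hK
  have hr : LegDecay (rowMM (KStepUnit (d := d) Lc i) Lc) Lc CK mK := legDecay_rowMM hK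
  cases n with
  | zero =>
    refine ⟨Lc, CK, mK, hmK, ?_, ?_⟩
    · simp only [Nat.add_zero, legComp_respStep_self]; exact hc
    · simp only [Nat.add_zero, legComp_respStep_self]; exact hr
  | succ m =>
    obtain ⟨C₁, m₁, hm₁, h₁⟩ := exists_legDecay_respStep_multi (d := d) (Lc := Lc) (i + 1) m
    rw [show i + 1 + m + 1 = i + (m + 1) + 1 by omega] at h₁
    -- a composite rate `m'` with `m' ≤ mK` and `m' · Lc < m₁`
    obtain ⟨m', hm'0, hm'₂, hm'₁⟩ : ∃ m' : ℝ, 0 < m' ∧ m' ≤ mK ∧ m' * (Lc : ℕ) < m₁ := by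
      refine ⟨min mK (m₁ / (2 * ((Lc : ℝ) + 1))), lt_min hmK (by positivity), min_le_left _ _, ?_⟩
      have hN : (0 : ℝ) ≤ (Lc : ℝ) := Nat.cast_nonneg _
      have hpos : (0 : ℝ) < 2 * ((Lc : ℝ) + 1) := by positivity
      have h1 : min mK (m₁ / (2 * ((Lc : ℝ) + 1))) * (Lc : ℝ) ≤ m₁ / (2 * ((Lc : ℝ) + 1)) * (Lc : ℝ) :=
        mul_le_mul_of_nonneg_right (min_le_right _ _) hN
      have h2 : m₁ / (2 * ((Lc : ℝ) + 1)) * (Lc : ℝ) < m₁ := by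
        calc m₁ / (2 * ((Lc : ℝ) + 1)) * (Lc : ℝ)
            < m₁ / (2 * ((Lc : ℝ) + 1)) * (2 * ((Lc : ℝ) + 1)) := mul_lt_mul_of_pos_left (by linarith) (div_pos hm₁ hpos)
          _ = m₁ := div_mul_cancel₀ _ hpos.ne'
      exact h1.trans_lt h2
    exact ⟨Lc * Lc ^ (m + 1), (d + 1 : ℕ) * (C₁ * CK * Zl (d + 1) (m₁ - m' * (Lc : ℕ))), m', hm'0,
      legDecay_legComp h₁ hc hm'0.le hm'₂ hm'₁, legDecay_legComp h₁ hr hm'0.le hm'₂ hm'₁⟩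

end Legs

/-! ## §2 The contact letter `hCgV` of the V-born row (`d = 3`) -/

section Three

variable {Lc : ℕ} [NeZero Lc]

/-- NOT IN PRINT; OUR PROOF ATTEMPT of the V analogue of the count BORNSEC-PLAN v1.1 §0 (c), ASSEMBLED ((C4)-V END).  **THE CONTACT LETTER OF THE V-BORN ROW** (`d = 3`,
`2 ≤ Lc`): at the pin `|cE| ≤ Lc^4` and for every scale `cVH` there are `C ≥ 0` and `δ > 0` such that, with `θ = Lc⁻¹ ∈ [0,1)`, for EVERY in-block root `rr ∈ box (3+1) Lc` and EVERY
lineage `i < k`, `LocStencil (D_{i,k} − U_{i,k}) (C·((k−i)^1·θ^{k−i})) δ` — `D_{i,k} = transport unitStepMap (i+1) (k−1−i) X_i` the dressed V lineage, `U_{i,k}` its undressed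
comparison — LITERALLY the binder `hCg` of leaf-01's `BornBorderLetters.exists_hCv_of_polyGeometric` with `p = 1`.  Per lineage `k = i+n+1`: (C1) `contact_v_eq_of_top ∕ _of_succ`
(the V contact has NO multiplier-slot cell — (A) `MultiplierLegWard` inside), then (C2) `abs_weight_mul_contact_v_le_three` with the tree letters ((N1), the dressed envelope) and
§1's tent ∕ localisation of the multiplier legs (`colM ∕ rowMM K̃_i Lc` at the top, their composites with `respStep (Lc^(i+1)) (Lc^k)` below); rate `min δ_t κ₁ ∕ 96`. -/
theorem exists_hCgV_three (hLc : 2 ≤ Lc) (cE cVH : ℝ) (hcE : |cE| ≤ (Lc : ℝ) ^ 4) :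
    ∃ C θ δ : ℝ, 0 ≤ C ∧ 0 ≤ θ ∧ θ < 1 ∧ 0 < δ ∧ ∀ (rr : Fin (3 + 1) → ℕ), rr ∈ box (3 + 1) Lc → ∀ k i : ℕ, i < k →
      LocStencil (transport (unitStepMap Lc (toSite rr) cE) (i + 1) (k - 1 - i)
          (unitStepMap Lc (toSite rr) cE i (fun κ u => cVH • vhSAt (toSite rr) 3 Lc rfl κ u))
        - fun κ' u' => (cE * (Lc : ℝ) ^ (2 * (3 + 1))) ^ (k - i) •
          push₃ (respStep (d := 3) (Lc ^ (i + 1)) (Lc ^ k)) (respStep (d := 3) (Lc ^ (i + 1)) (Lc ^ k)) (respStep (d := 3) (Lc ^ (i + 1)) (Lc ^ k))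
            (fun κ u => -(push₃ (-respStep (d := 3) (Lc ^ i) (Lc ^ (i + 1))) (colM (KStepUnit (d := 3) Lc i) Lc)
                  (respStep (d := 3) (Lc ^ i) (Lc ^ (i + 1))) (reslot Sum.inl Sum.inr fun κ u => cVH • vhSAt (toSite rr) 3 Lc rfl κ u) κ u
              + push₃ (rowMM (KStepUnit (d := 3) Lc i) Lc) (respStep (d := 3) (Lc ^ i) (Lc ^ (i + 1)))
                  (respStep (d := 3) (Lc ^ i) (Lc ^ (i + 1))) (reslot Sum.inr Sum.inl fun κ u => cVH • vhSAt (toSite rr) 3 Lc rfl κ u) κ u)) κ' u')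
        (C * (((k - i : ℕ) : ℝ) ^ 1 * θ ^ (k - i))) δ := by
  have hLc1 : 1 ≤ Lc := le_trans (by norm_num) hLc
  have hL : (0 : ℝ) < (Lc : ℝ) := Nat.cast_pos.2 (Nat.pos_of_ne_zero (NeZero.ne Lc))
  -- the tree letters, constants outside every ∀
  obtain ⟨κ₁, C₁, -, hκ₁, hC₁, -, hN1raw, -⟩ := exists_respStep_decay_and_grad (Lc := Lc)
  have hN1 : ∀ (m k : ℕ) (μ : Fin (3 + 1)) (z : Site (3 + 1)) (l'' : Fin (3 + 1)) (w' : Site (3 + 1)),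
      |respStep (d := 3) (Lc ^ m) (Lc ^ (m + k + 1)) μ z l'' w'| ≤
        C₁ * ((Lc : ℝ) ^ (5 * (k + 1)))⁻¹ * Real.exp (-(κ₁ * supNorm (quo (Lc ^ (k + 1)) w' - z))) := by
    intro m k μ z l'' w'
    have h := hN1raw m k μ z l'' w'
    rwa [inv_cast_pow_pow] at h
  obtain ⟨κE, KE, hκE, -, hEnv⟩ := exists_legChain_envelope (Lc := Lc) hLc
  obtain ⟨κ₀, hκ₀, Cst, hK⟩ := unitDecayK_holds (Lc := Lc)
  have hδt : 0 < κ₀ / ((3 + 1) * (Lc : ℝ)) := by positivity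
  have hCt : 0 ≤ Cst * Real.exp (2 * κ₀) := (hK 0).nonneg (Sum.inl 0)
  have hTb : 0 ≤ Cst * Real.exp (2 * κ₀) * Real.exp (κ₀ / ((3 + 1) * (Lc : ℝ))) := by positivity
  have hκ : 0 < min (κ₀ / ((3 + 1) * (Lc : ℝ))) κ₁ := lt_min hδt hκ₁
  have hZ : 0 ≤ Zl (3 + 1) (min (κ₀ / ((3 + 1) * (Lc : ℝ))) κ₁ / (4 * ((3 : ℝ) + 1))) := Zl_nonneg (by positivity)
  refine ⟨|cVH| * (2 * ((Lc : ℝ) ^ 3 * (((Lc : ℝ) ^ (3 + 1))⁻¹ * (((3 : ℝ) + 1) * (Cst * Real.exp (2 * κ₀) * Real.exp (κ₀ / ((3 + 1) * (Lc : ℝ))))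
            * (Real.exp (2 * ((3 : ℝ) + 1) * min (κ₀ / ((3 + 1) * (Lc : ℝ))) κ₁) ^ 2 *
              (((2 * Lc : ℕ) : ℝ) ^ (3 + 1) * (((3 + 1 : ℕ) : ℝ) * ((Lc : ℝ) ^ (3 + 1) * (ell (3 + 1) Lc : ℝ))))))
            * (C₁ ^ 2 * ((Lc : ℝ) * (64 + 544 * Lc + 768 * (Lc : ℝ) ^ 2))) * Zl (3 + 1) (min (κ₀ / ((3 + 1) * (Lc : ℝ))) κ₁ / (4 * ((3 : ℝ) + 1)))))),
    (Lc : ℝ)⁻¹, min (κ₀ / ((3 + 1) * (Lc : ℝ))) κ₁ / 12 / 2 / ((3 : ℝ) + 1), by positivity, (inv_pos.2 hL).le, ?_, by positivity, ?_⟩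
  · have h2 : (2 : ℝ) ≤ Lc := by exact_mod_cast hLc
    rw [inv_lt_one_iff₀]; right; linarith
  intro rr hrr k i hik
  obtain ⟨n, rfl⟩ : ∃ n, k = i + n + 1 := ⟨k - i - 1, by omega⟩
  -- the lineage's dressed envelope
  have hE : ∀ μ z' l u, |legChain (respStepBmSeq (d := 3) (toSite rr) Lc) i n μ z' l u|
      ≤ (KE * ((Lc : ℝ) ^ (4 * (n + 1)))⁻¹) * Real.exp (-(κE * supNorm (quo (Lc ^ (n + 1)) u - z'))) :=
    fun μ z' l u => hEnv rr hrr i n μ z' l u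
  intro κ' u'
  simp only [Pi.sub_apply]
  cases n with
  | zero =>
    -- the top lineage: multiplier legs `colM ∕ rowMM K̃_i Lc`
    obtain ⟨CK, mK, hmK, hKi⟩ := decays_KStepUnit_levels (d := 3) (Lc := Lc) i
    have hcol : LegDecay (colM (KStepUnit (d := 3) Lc i) Lc) Lc CK mK := legDecay_colM hKi
    have hrow : LegDecay (rowMM (KStepUnit (d := 3) Lc i) Lc) Lc CK mK := legDecay_rowMM hKi
    have hMt : ∀ (a : Fin (3 + 1)) (b : Site (3 + 1)) (μ : Fin (3 + 1)) (y : Site (3 + 1)),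
        |colM (KStepUnit (d := 3) Lc i) Lc a b μ ((Lc : ℤ) • y)| ≤ Cst * Real.exp (2 * κ₀) * Real.exp (κ₀ / ((3 + 1) * (Lc : ℝ)))
          * ((((Lc : ℝ) ^ 0) ^ (2 * 3 + 1))⁻¹) * Real.exp (-(κ₀ / ((3 + 1) * (Lc : ℝ)) * supNorm (quo (Lc ^ 0) y - b))) := by
      intro a b μ y
      have h := abs_legComp_colM_zsmul_le hK hδt.le i 0 a b μ y
      simp only [Nat.add_zero, legComp_respStep_self] at h
      exact h
    have hM't : ∀ (a : Fin (3 + 1)) (b : Site (3 + 1)) (μ : Fin (3 + 1)) (y : Site (3 + 1)),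
        |rowMM (KStepUnit (d := 3) Lc i) Lc a b μ ((Lc : ℤ) • y)| ≤ Cst * Real.exp (2 * κ₀) * Real.exp (κ₀ / ((3 + 1) * (Lc : ℝ)))
          * ((((Lc : ℝ) ^ 0) ^ (2 * 3 + 1))⁻¹) * Real.exp (-(κ₀ / ((3 + 1) * (Lc : ℝ)) * supNorm (quo (Lc ^ 0) y - b))) := by
      intro a b μ y
      have h := abs_legComp_rowMM_zsmul_le hK hδt.le i 0 a b μ y
      simp only [Nat.add_zero, legComp_respStep_self] at h
      exact h
    rw [contact_v_eq_of_top hrr cE cVH rfl κ' u']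
    intro x z a b
    simp only [Pi.neg_apply, Pi.smul_apply, Pi.add_apply, Pi.sub_apply, smul_eq_mul, abs_neg]
    have H := abs_weight_mul_contact_v_le_three (cVH := cVH) hLc hrr hcE hN1 hκ₁ hC₁ hE hκE (hcol.summable hmK) hMt (fun a b μ z => hrow.abs_le hmK.le a b μ z)
      (hrow.summable hmK) hM't hδt hTb κ' u' x z a b
    have e2 : i + 0 + 1 - i = 0 + 1 := by omega
    simpa only [e2, pow_one, Nat.cast_succ, Nat.cast_zero] using H
  | succ m =>
    -- a nested lineage: composite multiplier legs
    obtain ⟨N, CM, mM, hmM, hcol, hrow⟩ := exists_legDecay_mulLegs (d := 3) (Lc := Lc) i (m + 1)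
    have hMt := fun (a : Fin (3 + 1)) (b : Site (3 + 1)) (μ : Fin (3 + 1)) (y : Site (3 + 1)) => abs_legComp_colM_zsmul_le hK hδt.le i (m + 1) a b μ y
    have hM't := fun (a : Fin (3 + 1)) (b : Site (3 + 1)) (μ : Fin (3 + 1)) (y : Site (3 + 1)) => abs_legComp_rowMM_zsmul_le hK hδt.le i (m + 1) a b μ y
    rw [contact_v_eq_of_succ hLc hrr cE cVH rfl κ' u']
    intro x z a b
    simp only [Pi.neg_apply, Pi.smul_apply, Pi.add_apply, Pi.sub_apply, smul_eq_mul, abs_neg]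
    have H := abs_weight_mul_contact_v_le_three (cVH := cVH) hLc hrr hcE hN1 hκ₁ hC₁ hE hκE (hcol.summable hmM) hMt (fun a b μ z => hrow.abs_le hmM.le a b μ z)
      (hrow.summable hmM) hM't hδt hTb κ' u' x z a b
    have e2 : i + (m + 1) + 1 - i = m + 1 + 1 := by omega
    simpa only [e2, pow_one, Nat.cast_succ] using H

/-! ## §3 Docking certificate: leaf-01's (V-1) socket `exists_hCv_of_polyGeometric` consumes the letter by name (`p = 1`) -/

/-- NOT IN PRINT; OUR BOOKKEEPING ((V-C) summed over the lineages; [folklore] once §2 is given).  **THE CONTACT PART OF THE V-BORN ROW IS A LOCAL STENCIL FAMILY, UNIFORMLY IN THE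
MEMBER AND THE IN-BLOCK ROOT** (`d = 3`, `2 ≤ Lc`, `|cE| ≤ Lc^4`): `∃ C δ, 0 < δ ∧ ∀ rr ∈ box (3+1) Lc, ∀ k, LocStencil (Σ_{i<k} (D_{i,k} − U_{i,k})) C δ` — leaf-01 g60's
`BornBorderLetters.exists_hCv_of_polyGeometric (p := 1)` applied to §2, no rewrite: the certificate that §2 IS that binder.  What remains for `hB` of the V half is the OWNER's
(V-U) undressed letter `hUg` (his staged V socket ∕ `BornBorderLiftChain` ∕ `BornBorderUndressedRow` over gan24-p2's three landed `SymAt` ENDs), then leaf-01's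
`exists_hBv_of_geometric_poly`; nothing of that is claimed here. -/
theorem exists_hCv_three (hLc : 2 ≤ Lc) (cE cVH : ℝ) (hcE : |cE| ≤ (Lc : ℝ) ^ 4) :
    ∃ C δ : ℝ, 0 < δ ∧ ∀ (rr : Fin (3 + 1) → ℕ), rr ∈ box (3 + 1) Lc → ∀ k : ℕ,
      LocStencil (∑ i ∈ Finset.range k, (transport (unitStepMap Lc (toSite rr) cE) (i + 1) (k - 1 - i)
          (unitStepMap Lc (toSite rr) cE i (fun κ u => cVH • vhSAt (toSite rr) 3 Lc rfl κ u))
        - fun κ' u' => (cE * (Lc : ℝ) ^ (2 * (3 + 1))) ^ (k - i) •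
          push₃ (respStep (d := 3) (Lc ^ (i + 1)) (Lc ^ k)) (respStep (d := 3) (Lc ^ (i + 1)) (Lc ^ k)) (respStep (d := 3) (Lc ^ (i + 1)) (Lc ^ k))
            (fun κ u => -(push₃ (-respStep (d := 3) (Lc ^ i) (Lc ^ (i + 1))) (colM (KStepUnit (d := 3) Lc i) Lc)
                  (respStep (d := 3) (Lc ^ i) (Lc ^ (i + 1))) (reslot Sum.inl Sum.inr fun κ u => cVH • vhSAt (toSite rr) 3 Lc rfl κ u) κ u
              + push₃ (rowMM (KStepUnit (d := 3) Lc i) Lc) (respStep (d := 3) (Lc ^ i) (Lc ^ (i + 1)))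
                  (respStep (d := 3) (Lc ^ i) (Lc ^ (i + 1))) (reslot Sum.inr Sum.inl fun κ u => cVH • vhSAt (toSite rr) 3 Lc rfl κ u) κ u)) κ' u')) C δ :=
  exists_hCv_of_polyGeometric cE cVH 1 (exists_hCgV_three hLc cE cVH hcE)

end Three

end Summit.QuantumFields.BalabanUV.Beta.GAN24.BornBorderContactBound
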